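import Summits.ResolutionOfSingularities.ResolutionOfSingularities.Theorems.MarkedTransferCampaignW21ExponentZeroWitness
import HarnessLib

/-!
# [OURS · L1 W2.1] The named order bounds of the W2.1 vocabulary are FALSE AS TYPED (the `e = 0` slice)

Rung L (rescue) of cell res-hironaka, RESCUE-SEED row L-G2, slot W2.1, seat res-L1-s21-pv-1. From the `e = 0` witness
datum of `MarkedTransferCampaignW21ExponentZeroWitness.lean` (`ε = y x⁴ + y x³ + x⁴ ∈ 𝔽_p⟦y,x⟧`, `q = p⁰ = 1`, `m = 0`,
`γ₀ = (0,4)`, `Standing` + Case (I) + `ShortTopGamma`/`LongGammas`/`ExactClass`, `ord H♭(ε) ≤ 3 < 4 = ord ε`) this file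
proves, for EVERY prime `p`: `¬ LucasBound p`, `¬ OrderBoundInClass p` (the slot's named theorem-to-prove AS TYPED),
`¬ OrderBoundLongGammas p`, `¬ OrderBoundExact p`, `¬ OrderFormulaCaseI p`, `¬ OrderBoundOpInClass p` (vocabulary
`MarkedTransferCampaignW21OrderBoundInClass.lean`, res-L1-type-o3, v4 p465799).

CLASSIFICATION (prover's release note): refuted-MISSTATED, not substantive — the witness exploits only the missing
side condition `0 < e` (the manuscript's standing «ℓ ≫ e > 0», p.48 L25–L26, which the binder `(n e ℓ : ℕ)` of
`OrderBoundOn` / `LucasBound` / `OrderFormulaCaseI` / `OrderBoundOpOn` does not carry); the REPAIRED statements — the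
same bounds under `0 < e`, typed as the ERRATUM companion `MarkedTransferCampaignW21OrderBoundPos.lean` (res-L1-type-o3,
p469452: `LucasBoundPos`, `OrderBoundInClassPos`, …) — are PROVED in `MarkedTransferCampaignW21LucasBound.lean` (p473059:
`CampaignW21.lucasBoundPos_holds`, `orderBoundInClassPos_holds`, `orderBoundLongGammasPos_holds`), and the witness misses
them (`e = 0`). `OrderBoundMinDegreeTop p`
(res-L1-k21, p463892) and `OrderBoundCaseII p` hold for all `e` and are not touched; k21's reductions (p465215) stay
valid implications. Everything here is OURS / folklore about OURS statements; nothing is a statement of or about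
the manuscript under adjudication (GAP row R05); AI-produced formalisation, expert review is stronger than AI review.
-/

noncomputable section

set_option linter.dupNamespace false -- mandated namespace of this single-conjunct summit

namespace Summit.ResolutionOfSingularities.ResolutionOfSingularities.Theorems

namespace CampaignW21

open Literature.AlgebraicGeometry.Hironaka2017.S08UnitMonomial
open Literature.AlgebraicGeometry.Hironaka2017.S09LLUED
open Literature.AlgebraicGeometry.Hironaka2017.S09LLUED.TopFrontier
open Literature.AlgebraicGeometry.Resolution
open Literature.RingTheory.MvPowerSeries
open MvPowerSeries Finsupp

/-! ## The refutations (every prime `p`) -/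

open ExponentZeroWitness

/-- **[OURS · L1 W2.1] `¬ LucasBound p` for every prime `p`** — refuted-MISSTATED: the binder `e` ranges over
`ℕ` and the `e = 0` witness `ε = y x⁴ + y x³ + x⁴ ∈ 𝔽_p⟦y,x⟧` (`q = 1`, `m = 0`, `γ₀ = (0,4)`) has
`q|γ₀| + (ord ε ∸ q|γ₀|) = 4 > 3 = ord H♭(ε)`. Repaired statement: the same with `0 < e`
(`LucasBoundPos p`, proved as `CampaignW21.lucasBoundPos_holds`); the witness misses it. NOT a statement about the manuscript. [folklore] -/
theorem not_lucasBound (p : ℕ) [Fact p.Prime] : ¬ LucasBound p := by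
  intro h
  obtain ⟨j, hj⟩ := h (ZMod p) 2 0 3 (eps p) (stdExpr p) (frontierLength_pos p) (standing p)
  have hle := hj.trans (adicOrder_caseI_le p _ (standing_unit_eq p))
  change ((p ^ 0 * (gamma T (uu p) j).degree : ℕ) : ℕ∞) +
      (adicOrder (eps p) - ((p ^ 0 * (gamma T (uu p) ⟨0, frontierLength_pos p⟩).degree : ℕ) : ℕ∞)) ≤
    ((3 : ℕ) : ℕ∞) at hle
  rw [gamma_eq, gamma_eq, adicOrder_eps, pow_zero, one_mul, ex_degree, zero_add, tsub_self, add_zero,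
    Nat.cast_le] at hle
  omega

/-- **[OURS · L1 W2.1] `¬ OrderBoundInClass p` for every prime `p`** (the slot's named theorem-to-prove AS TYPED) —
refuted-MISSTATED by the `e = 0` witness (Case (I), `ShortTopGamma`, `ord H♭(ε) = 3 < 4 = ord ε`). Repaired
statement: `0 < e` added to the binders (`OrderBoundInClassPos p`, proved as `CampaignW21.orderBoundInClassPos_holds`); the witness misses it.
NOT a statement about the manuscript (whose standing assumption is `e > 0`, p.48 L25–L26). [folklore] -/
theorem not_orderBoundInClass (p : ℕ) [Fact p.Prime] : ¬ OrderBoundInClass p := by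
  intro h
  have hle := (h (ZMod p) 2 0 3 (eps p) (stdExpr p) (frontierLength_pos p) (standing p) (isCaseI p)
    (lucasClass p)).trans (adicOrder_caseI_le p _ (standing_unit_eq p))
  rw [adicOrder_eps, Nat.cast_le] at hle
  omega

/-- **[OURS · L1 W2.1] `¬ OrderBoundLongGammas p` for every prime `p`** — refuted-MISSTATED by the same `e = 0`
witness (`ord ε = 4 = q|γ₀|`, so it lies in `LongGammas`). Repaired by `0 < e`. [folklore] -/
theorem not_orderBoundLongGammas (p : ℕ) [Fact p.Prime] : ¬ OrderBoundLongGammas p := by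
  intro h
  have hle := (h (ZMod p) 2 0 3 (eps p) (stdExpr p) (frontierLength_pos p) (standing p) (isCaseI p)
    (longGammas p)).trans (adicOrder_caseI_le p _ (standing_unit_eq p))
  rw [adicOrder_eps, Nat.cast_le] at hle
  omega

/-- **[OURS · L1 W2.1] `¬ OrderBoundExact p` for every prime `p`** — refuted-MISSTATED by the same `e = 0` witness
(it lies in `ExactClass`: every effective term has degree `≥ 4 = ord ε`). Repaired by `0 < e`. [folklore] -/
theorem not_orderBoundExact (p : ℕ) [Fact p.Prime] : ¬ OrderBoundExact p := by
  intro h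
  have hle := (h (ZMod p) 2 0 3 (eps p) (stdExpr p) (frontierLength_pos p) (standing p) (isCaseI p)
    (exactClass p)).trans (adicOrder_caseI_le p _ (standing_unit_eq p))
  rw [adicOrder_eps, Nat.cast_le] at hle
  omega

/-- **[OURS · L1 W2.1] `¬ OrderFormulaCaseI p` for every prime `p`** — refuted-MISSTATED by the same `e = 0` witness:
its second clause would give an effective term of total degree `≤ ord H♭(ε) = 3`, but every term has degree `≥ 4`.
Repaired by `0 < e`. [folklore] -/
theorem not_orderFormulaCaseI (p : ℕ) [Fact p.Prime] : ¬ OrderFormulaCaseI p := by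
  intro h
  obtain ⟨-, j, t, ht, -, hle⟩ := h (ZMod p) 2 0 3 (eps p) (stdExpr p) (frontierLength_pos p) (standing p)
  have hH := adicOrder_caseI_le p _ (standing_unit_eq p)
  have ht' : t ∈ effSupport T (uu p) := ht
  have h4 := four_le_degree_of_mem p ht'
  have := hle.trans (add_le_add hH le_rfl)
  change ((p ^ 0 * (gamma T (uu p) j).degree + (t.1 + p • t.2.1 + p ^ 0 • t.2.2).degree : ℕ) : ℕ∞) ≤
    ((3 : ℕ) : ℕ∞) + ((p ^ 0 * (gamma T (uu p) ⟨0, frontierLength_pos p⟩).degree : ℕ) : ℕ∞) at this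
  generalize (t.1 + p • t.2.1 + p ^ 0 • t.2.2).degree = N at h4 this
  rw [gamma_eq, gamma_eq, ← Nat.cast_add, Nat.cast_le, pow_zero, one_mul, ex_degree] at this
  omega

/-- **[OURS · L1 W2.1] `¬ OrderBoundOpInClass p` for every prime `p`** — the by-case form over `HFlat.op` inherits
the Case-(I) failure at `e = 0` (case witness `HFlat.Case.I`). Repaired by `0 < e`. [folklore] -/
theorem not_orderBoundOpInClass (p : ℕ) [Fact p.Prime] : ¬ OrderBoundOpInClass p := by
  intro h
  have hle := (h (ZMod p) 2 0 3 (eps p) (stdExpr p) (frontierLength_pos p) (standing p)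
    (HFlat.Case.I (isCaseI p)) (lucasClass p)).trans (adicOrder_caseI_le p _ (standing_unit_eq p))
  rw [adicOrder_eps, Nat.cast_le] at hle
  omega

end CampaignW21

end Summit.ResolutionOfSingularities.ResolutionOfSingularities.Theorems

end
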